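import Summits.Parity.GeneralizedHardyLittlewood.Theses.DeterminantMoebiusCores
import Summits.Parity.GeneralizedHardyLittlewood.Theorems.PairsToGHL.Negative.UnboundedSiegelZeros

/-!
# Strategist sketch for the crux `PairCores` (stmt-Parity-15171) — typed census material

planner-cstrat-stmt-Parity-15171-s1-0, 2026-08-17. Companion of `Cruxes/PairCores/STRATEGY-CENSUS.md`.
Everything here ELABORATES (no `sorry`): typed forms of the candidate strengthenings / splits / negation
targets discussed in the census, with the glue implications PROVED where the census says "glue proved".
Nothing in this file is an item, a stub or a proposal.

* §0  `PairCoresAt ν` (the crux at a fixed level) and `pairCores_iff_levels`.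
* §D-b level split: `LevelZero`, `LevelLift`, glue `pairCores_of_levelSplit` + converses.
* §D-θ θ-lift: `PairCoresHighTrunc κ₀` (the crux restricted to truncations `θ ≥ 1/2 − ν − κ₀`),
  `BandReduction κ₀`, glue `pairCores_of_thetaLift` + converse `highTrunc_of_pairCores`
  (the registered alternative line `Lines/theta-lift.lean` is the skeleton form of this split).
* §D-e modulus-range split (typed pieces only): `SmallModuli`, `LargeModuli`.
* §D-f one-sided re-opening (typed pieces only): `FlatCore`, `PrimeCore`.
* §S⁺  `PowerSavingPairCores` with `pairCores_of_powerSaving : S⁺ → PairCores` PROVED.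
* §N   Siegel chain: `not_pairCores_of_unboundedSiegelZeros` (kernel-checked, via the route's own `closes`
  and the tree's `PairsToGHL.Negative.not_generalizedHardyLittlewood_of_unboundedSiegelZeros`), and the
  sharper typed chain `negation_chain : OpeningAtLevelZero → SiegelKillsPairs → USZ → ¬PairCores`.
-/

set_option linter.unusedVariables false

namespace Summit.Parity.GeneralizedHardyLittlewood.Cruxes.PairCores.Strategist

open scoped BigOperators Classical
open Summit.Parity.GeneralizedHardyLittlewood.Theses.DeterminantMoebiusCores

/-! ### §0 The crux at a fixed level -/

/-- `PairCores` at ONE level `ν` (all other quantifiers as in the crux, verbatim frame). -/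
def PairCoresAt (ν : ℝ) : Prop :=
  ∀ (L : ℕ) (θ A C : ℝ), 0 < θ → ν + θ < 1 / 2 → 0 < A → 0 ≤ C → ∃ N₀ : ℕ, ∀ N : ℕ, N₀ ≤ N →
    ∀ Ψ : Fin 2 → Literature.NumberTheory.Sieve.AffLinForm 1,
      Literature.NumberTheory.Sieve.IsNondegenerateSystem Ψ →
      Literature.NumberTheory.Sieve.affLinSize Ψ N ≤ L →
      ∀ (r u v : ℕ → ℤ), (∀ q : ℕ, -(N : ℤ) ≤ u q ∧ v q ≤ N) →
        ∑ q ∈ Finset.Icc 1 ⌊(N : ℝ) ^ ν⌋₊, ((Nat.divisors q).card : ℝ) ^ C *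
          (if ∀ i : Fin 2, ((Int.gcd ((Ψ i).eval (fun _ => r q)) q : ℕ) : ℝ) ≤ (N : ℝ) ^ (θ / 2) then
            |∑ n ∈ (Finset.Icc (u q) (v q)).filter (fun n : ℤ => (q : ℤ) ∣ n - r q),
              ∏ i : Fin 2, (∑ d ∈ Nat.divisors ((Ψ i).eval (fun _ => n)).toNat,
                if (N : ℝ) ^ θ < (d : ℝ) then
                  (ArithmeticFunction.moebius d : ℝ) *
                    Real.log (((((Ψ i).eval (fun _ => n)).toNat : ℕ) : ℝ) / (d : ℝ))
                else 0)|
          else 0) ≤ (N : ℝ) / Real.log N ^ A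

/-- The crux is the conjunction of its level slices over `ν ≥ 0` (binder reordering only). -/
theorem pairCores_iff_levels : PairCores ↔ ∀ ν : ℝ, 0 ≤ ν → PairCoresAt ν := by
  constructor
  · intro h ν hν L θ A C hθ hνθ hA hC
    exact h L θ ν A C hθ hν hνθ hA hC
  · intro h L θ ν A C hθ hν hνθ hA hC
    exact h ν hν L θ A C hθ hνθ hA hC

/-! ### §D-b The level split (route header TWO-LAYER PLAN: PairCoresLevelZero → PairCoresDispersion → PairCores) -/

/-- Level `0`: `q = 1` only (tame for `N ≥ 1`): `|∑_{u ≤ n ≤ v} Λ♯(ψ₁(n))Λ♯(ψ₂(n))| ≤ N/(log N)^A`, shift-uniform,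
all pair systems — given the provable `t = 2` opening bookkeeping this is Hardy–Littlewood for PAIRS with a
`(log N)^{−A}` RATE, uniformly in shifts `≤ LN` (HL-complete; Siegel-sensitive, §N). -/
def LevelZero : Prop := PairCoresAt 0

/-- The 'dispersion' piece of the level split: level `0` ⇒ level `ν`. Its ONE-point sibling is exactly the
Bombieri–Vinogradov theorem (Siegel–Walfisz ⇒ level `1/2` by the large sieve); the transfer breaks because
`n ↦ Λ♯(ψ₁(n))Λ♯(ψ₂(n))` has no Dirichlet-convolution structure in `n` (census §Transfer T1). -/
def LevelLift : Prop := PairCoresAt 0 → PairCores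

/-- Glue of the level split (modus ponens). -/
theorem pairCores_of_levelSplit : LevelZero → LevelLift → PairCores := fun h0 hL => hL h0

/-- Converse 1: the crux gives its level-0 slice. -/
theorem levelZero_of_pairCores : PairCores → LevelZero := fun h => (pairCores_iff_levels.mp h) 0 le_rfl

/-- Converse 2: the crux gives the lift trivially — so `LevelLift` is a genuine piece only in the sense of a
bridge `T ∧ (T → S)` with `T = LevelZero` substantive. -/
theorem levelLift_of_pairCores : PairCores → LevelLift := fun h _ => h

/-! ### §D-θ The θ-lift (typed form of line `theta-lift`) -/

/-- The crux RESTRICTED to high truncations `θ ≥ 1/2 − ν − κ₀`: both Möbius variables `> N^{1/2−ν−κ₀}`. -/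
def PairCoresHighTrunc (κ₀ : ℝ) : Prop :=
  ∀ (L : ℕ) (θ ν A C : ℝ), 0 < θ → 0 ≤ ν → ν + θ < 1 / 2 → 1 / 2 - ν - κ₀ ≤ θ → 0 < A → 0 ≤ C →
    ∃ N₀ : ℕ, ∀ N : ℕ, N₀ ≤ N →
    ∀ Ψ : Fin 2 → Literature.NumberTheory.Sieve.AffLinForm 1,
      Literature.NumberTheory.Sieve.IsNondegenerateSystem Ψ →
      Literature.NumberTheory.Sieve.affLinSize Ψ N ≤ L →
      ∀ (r u v : ℕ → ℤ), (∀ q : ℕ, -(N : ℤ) ≤ u q ∧ v q ≤ N) →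
        ∑ q ∈ Finset.Icc 1 ⌊(N : ℝ) ^ ν⌋₊, ((Nat.divisors q).card : ℝ) ^ C *
          (if ∀ i : Fin 2, ((Int.gcd ((Ψ i).eval (fun _ => r q)) q : ℕ) : ℝ) ≤ (N : ℝ) ^ (θ / 2) then
            |∑ n ∈ (Finset.Icc (u q) (v q)).filter (fun n : ℤ => (q : ℤ) ∣ n - r q),
              ∏ i : Fin 2, (∑ d ∈ Nat.divisors ((Ψ i).eval (fun _ => n)).toNat,
                if (N : ℝ) ^ θ < (d : ℝ) then
                  (ArithmeticFunction.moebius d : ℝ) *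
                    Real.log (((((Ψ i).eval (fun _ => n)).toNat : ℕ) : ℝ) / (d : ℝ))
                else 0)|
          else 0) ≤ (N : ℝ) / Real.log N ^ A

/-- The BAND REDUCTION at margin `κ₀`: high truncations suffice. PROVABLE for every `κ₀ > 0` in kind (the
bands `Λ♯_θ − Λ♯_{θ'}` are short divisor sums `d ≤ N^{1/2−ν−κ}` and un-open against the other factor by
Bombieri–Vinogradov for primes at level `< 1/2` plus lattice counts: `stub_bandTerms` of line `theta-lift`, with
the lift identity `lamSharp_mul_lift`; the tameness threshold moves from `N^{θ/2}` to the lifted statement's own,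
which is why the line keeps `θ` as the tame parameter rather than using this coarser typed form). -/
def BandReduction (κ₀ : ℝ) : Prop := PairCoresHighTrunc κ₀ → PairCores

/-- Glue of the θ-lift split (modus ponens). -/
theorem pairCores_of_thetaLift (κ₀ : ℝ) : PairCoresHighTrunc κ₀ → BandReduction κ₀ → PairCores :=
  fun h hB => hB h

/-- Converse: the crux contains its high-truncation slice (drop one hypothesis). -/
theorem highTrunc_of_pairCores (κ₀ : ℝ) : PairCores → PairCoresHighTrunc κ₀ :=
  fun h L θ ν A C hθ hν hνθ _ hA hC => h L θ ν A C hθ hν hνθ hA hC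

/-! ### §D-e The modulus-range split (Siegel–Walfisz range / large-sieve range; the cut of HigherCores' `birth`) -/

/-- Small moduli `q ≤ (log N)^B` (pointwise range; contains `LevelZero`). Typed piece only. -/
def SmallModuli : Prop :=
  ∀ (L : ℕ) (θ ν A C B : ℝ), 0 < θ → 0 ≤ ν → ν + θ < 1 / 2 → 0 < A → 0 ≤ C → 0 < B → ∃ N₀ : ℕ, ∀ N : ℕ, N₀ ≤ N →
    ∀ Ψ : Fin 2 → Literature.NumberTheory.Sieve.AffLinForm 1,
      Literature.NumberTheory.Sieve.IsNondegenerateSystem Ψ →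
      Literature.NumberTheory.Sieve.affLinSize Ψ N ≤ L →
      ∀ (r u v : ℕ → ℤ), (∀ q : ℕ, -(N : ℤ) ≤ u q ∧ v q ≤ N) →
        ∑ q ∈ (Finset.Icc 1 ⌊(N : ℝ) ^ ν⌋₊).filter (fun q : ℕ => (q : ℝ) ≤ Real.log N ^ B),
          ((Nat.divisors q).card : ℝ) ^ C *
          (if ∀ i : Fin 2, ((Int.gcd ((Ψ i).eval (fun _ => r q)) q : ℕ) : ℝ) ≤ (N : ℝ) ^ (θ / 2) then
            |∑ n ∈ (Finset.Icc (u q) (v q)).filter (fun n : ℤ => (q : ℤ) ∣ n - r q),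
              ∏ i : Fin 2, (∑ d ∈ Nat.divisors ((Ψ i).eval (fun _ => n)).toNat,
                if (N : ℝ) ^ θ < (d : ℝ) then
                  (ArithmeticFunction.moebius d : ℝ) *
                    Real.log (((((Ψ i).eval (fun _ => n)).toNat : ℕ) : ℝ) / (d : ℝ))
                else 0)|
          else 0) ≤ (N : ℝ) / Real.log N ^ A

/-- Large moduli `(log N)^B < q ≤ N^ν` (the `ℓ¹`-over-many-moduli range; for ONE point this is the large-sieve
range of Bombieri–Vinogradov; for pairs no large sieve is available — census §Transfer T1). Typed piece only;
the glue `SmallModuli → LargeModuli → PairCores` is the filter split of a sum of non-negative terms plus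
`2N/(log N)^{A+1} ≤ N/(log N)^A` (proved for `k ≥ 3` forms in `Cruxes/HigherCores/Lines/birth.lean`). -/
def LargeModuli : Prop :=
  ∀ (L : ℕ) (θ ν A C : ℝ), 0 < θ → 0 ≤ ν → ν + θ < 1 / 2 → 0 < A → 0 ≤ C → ∃ B : ℝ, 0 < B ∧ ∃ N₀ : ℕ, ∀ N : ℕ, N₀ ≤ N →
    ∀ Ψ : Fin 2 → Literature.NumberTheory.Sieve.AffLinForm 1,
      Literature.NumberTheory.Sieve.IsNondegenerateSystem Ψ →
      Literature.NumberTheory.Sieve.affLinSize Ψ N ≤ L →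
      ∀ (r u v : ℕ → ℤ), (∀ q : ℕ, -(N : ℤ) ≤ u q ∧ v q ≤ N) →
        ∑ q ∈ (Finset.Icc 1 ⌊(N : ℝ) ^ ν⌋₊).filter (fun q : ℕ => Real.log N ^ B < (q : ℝ)),
          ((Nat.divisors q).card : ℝ) ^ C *
          (if ∀ i : Fin 2, ((Int.gcd ((Ψ i).eval (fun _ => r q)) q : ℕ) : ℝ) ≤ (N : ℝ) ^ (θ / 2) then
            |∑ n ∈ (Finset.Icc (u q) (v q)).filter (fun n : ℤ => (q : ℤ) ∣ n - r q),
              ∏ i : Fin 2, (∑ d ∈ Nat.divisors ((Ψ i).eval (fun _ => n)).toNat,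
                if (N : ℝ) ^ θ < (d : ℝ) then
                  (ArithmeticFunction.moebius d : ℝ) *
                    Real.log (((((Ψ i).eval (fun _ => n)).toNat : ℕ) : ℝ) / (d : ℝ))
                else 0)|
          else 0) ≤ (N : ℝ) / Real.log N ^ A

/-! ### §D-f The one-sided re-opening (Sawin–Shusterman Thm 6.3 architecture): typed pieces -/

/-- `Λ♯_θ(m)` inlined as in the crux. -/
noncomputable def lamSharp (N : ℕ) (θ : ℝ) (m : ℕ) : ℝ :=
  ∑ d ∈ Nat.divisors m, if (N : ℝ) ^ θ < (d : ℝ) then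
    (ArithmeticFunction.moebius d : ℝ) * Real.log ((m : ℝ) / (d : ℝ)) else 0

/-- PRIME CORE: `Λ(ψ₁(n))` against `Λ♯(ψ₂(n))` in the crux frame — Möbius(-divisor-sum) along the primes of
`ψ₁`: after flipping `d ↦ e = ψ₂/d` it is `∑_{e < 2LN^{1−θ}} log e ∑_{n ≡ r_q (q), e ∣ ψ₂(n)} Λ(ψ₁(n)) μ(ψ₂(n)/e)`,
MÖBIUS–SHIFTED-PRIMES with dilations `e` and level `ν` (the `t = 1` atom of route ClassVarianceLadder's
`MobiusCofactorAtom` for `e ≤ N^δ`; BV range `e > N^{1/2+ν+ε}`; BFI/Maynard dispersion band in between for small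
`ν`). Open heart of the one-sided line. -/
def PrimeCore : Prop :=
  ∀ (L : ℕ) (θ ν A C : ℝ), 0 < θ → 0 ≤ ν → ν + θ < 1 / 2 → 0 < A → 0 ≤ C → ∃ N₀ : ℕ, ∀ N : ℕ, N₀ ≤ N →
    ∀ Ψ : Fin 2 → Literature.NumberTheory.Sieve.AffLinForm 1,
      Literature.NumberTheory.Sieve.IsNondegenerateSystem Ψ →
      Literature.NumberTheory.Sieve.affLinSize Ψ N ≤ L →
      ∀ (r u v : ℕ → ℤ), (∀ q : ℕ, -(N : ℤ) ≤ u q ∧ v q ≤ N) →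
        ∑ q ∈ Finset.Icc 1 ⌊(N : ℝ) ^ ν⌋₊, ((Nat.divisors q).card : ℝ) ^ C *
          (if ∀ i : Fin 2, ((Int.gcd ((Ψ i).eval (fun _ => r q)) q : ℕ) : ℝ) ≤ (N : ℝ) ^ (θ / 2) then
            |∑ n ∈ (Finset.Icc (u q) (v q)).filter (fun n : ℤ => (q : ℤ) ∣ n - r q),
              (ArithmeticFunction.vonMangoldt ((Ψ 0).eval (fun _ => n)).toNat : ℝ) *
                lamSharp N θ ((Ψ 1).eval (fun _ => n)).toNat|
          else 0) ≤ (N : ℝ) / Real.log N ^ A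

/-- FLAT CORE: `Λ♭_θ(ψ₁(n)) = Λ(ψ₁(n)) − Λ♯_θ(ψ₁(n))` (a SHORT divisor sum, `d ≤ N^θ`) against `Λ♯_θ(ψ₂(n))`:
ONE-point `Λ♯` sums in progressions of modulus `q·d ≤ N^{ν+θ} < N^{1/2}` — Bombieri–Vinogradov (proved) plus
lattice counts plus tame main-term matching: PROVABLE (L–XL). With the pointwise identity
`Λ♯Λ♯ = Λ·Λ♯ − Λ♭·Λ♯` and the triangle inequality, `FlatCore → PrimeCore → PairCores` (glue routine; the
2-way form of `weighted_sum_le_of_split4` of line `theta-lift`). -/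
def FlatCore : Prop :=
  ∀ (L : ℕ) (θ ν A C : ℝ), 0 < θ → 0 ≤ ν → ν + θ < 1 / 2 → 0 < A → 0 ≤ C → ∃ N₀ : ℕ, ∀ N : ℕ, N₀ ≤ N →
    ∀ Ψ : Fin 2 → Literature.NumberTheory.Sieve.AffLinForm 1,
      Literature.NumberTheory.Sieve.IsNondegenerateSystem Ψ →
      Literature.NumberTheory.Sieve.affLinSize Ψ N ≤ L →
      ∀ (r u v : ℕ → ℤ), (∀ q : ℕ, -(N : ℤ) ≤ u q ∧ v q ≤ N) →
        ∑ q ∈ Finset.Icc 1 ⌊(N : ℝ) ^ ν⌋₊, ((Nat.divisors q).card : ℝ) ^ C *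
          (if ∀ i : Fin 2, ((Int.gcd ((Ψ i).eval (fun _ => r q)) q : ℕ) : ℝ) ≤ (N : ℝ) ^ (θ / 2) then
            |∑ n ∈ (Finset.Icc (u q) (v q)).filter (fun n : ℤ => (q : ℤ) ∣ n - r q),
              ((ArithmeticFunction.vonMangoldt ((Ψ 0).eval (fun _ => n)).toNat : ℝ) -
                  lamSharp N θ ((Ψ 0).eval (fun _ => n)).toNat) *
                lamSharp N θ ((Ψ 1).eval (fun _ => n)).toNat|
          else 0) ≤ (N : ℝ) / Real.log N ^ A

/-! ### §S⁺ Power saving (strengthen-to-induct candidate) -/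

/-- `S⁺`: the crux with a POWER saving `N^{1−δ}` (δ may depend on `L, θ, ν, C`). -/
def PowerSavingPairCores : Prop :=
  ∀ (L : ℕ) (θ ν C : ℝ), 0 < θ → 0 ≤ ν → ν + θ < 1 / 2 → 0 ≤ C → ∃ δ : ℝ, 0 < δ ∧ ∃ N₀ : ℕ, ∀ N : ℕ, N₀ ≤ N →
    ∀ Ψ : Fin 2 → Literature.NumberTheory.Sieve.AffLinForm 1,
      Literature.NumberTheory.Sieve.IsNondegenerateSystem Ψ →
      Literature.NumberTheory.Sieve.affLinSize Ψ N ≤ L →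
      ∀ (r u v : ℕ → ℤ), (∀ q : ℕ, -(N : ℤ) ≤ u q ∧ v q ≤ N) →
        ∑ q ∈ Finset.Icc 1 ⌊(N : ℝ) ^ ν⌋₊, ((Nat.divisors q).card : ℝ) ^ C *
          (if ∀ i : Fin 2, ((Int.gcd ((Ψ i).eval (fun _ => r q)) q : ℕ) : ℝ) ≤ (N : ℝ) ^ (θ / 2) then
            |∑ n ∈ (Finset.Icc (u q) (v q)).filter (fun n : ℤ => (q : ℤ) ∣ n - r q),
              ∏ i : Fin 2, (∑ d ∈ Nat.divisors ((Ψ i).eval (fun _ => n)).toNat,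
                if (N : ℝ) ^ θ < (d : ℝ) then
                  (ArithmeticFunction.moebius d : ℝ) *
                    Real.log (((((Ψ i).eval (fun _ => n)).toNat : ℕ) : ℝ) / (d : ℝ))
                else 0)|
          else 0) ≤ (N : ℝ) ^ (1 - δ)

/-- `(log x)^A ≤ x^δ` for large `x` (from Mathlib's `isLittleO_log_rpow_rpow_atTop`). -/
theorem eventually_log_rpow_le_rpow (A : ℝ) {δ : ℝ} (hδ : 0 < δ) :
    ∃ X₀ : ℝ, ∀ x : ℝ, X₀ ≤ x → Real.log x ^ A ≤ x ^ δ := by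
  have h := (isLittleO_log_rpow_rpow_atTop A hδ).bound (show (0 : ℝ) < 1 by norm_num)
  have h' : ∀ᶠ x : ℝ in Filter.atTop, Real.log x ^ A ≤ x ^ δ := by
    filter_upwards [h, Filter.eventually_ge_atTop (1 : ℝ)] with x hx hx1
    rw [one_mul, Real.norm_eq_abs, Real.norm_eq_abs,
      abs_of_nonneg (Real.rpow_nonneg (Real.log_nonneg hx1) A),
      abs_of_nonneg (Real.rpow_nonneg (by linarith) δ)] at hx
    exact hx
  exact Filter.eventually_atTop.mp h'

/-- `S⁺ → S` PROVED: a power saving beats every log power. (The census records why the extra rigidity buys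
nothing for THIS step: no inductive variable; the binary barriers are insensitive to the error size.) -/
theorem pairCores_of_powerSaving : PowerSavingPairCores → PairCores := by
  intro h L θ ν A C hθ hν hνθ hA hC
  obtain ⟨δ, hδ, N₁, hN₁⟩ := h L θ ν C hθ hν hνθ hC
  obtain ⟨X₀, hX₀⟩ := eventually_log_rpow_le_rpow A hδ
  refine ⟨max (max N₁ ⌈X₀⌉₊) 3, fun N hN Ψ hΨ hL r u v huv => ?_⟩
  have hN₁' : N₁ ≤ N := le_trans (le_trans (le_max_left _ _) (le_max_left _ _)) hN
  have hceil : ⌈X₀⌉₊ ≤ N := le_trans (le_trans (le_max_right _ _) (le_max_left _ _)) hN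
  have hX : X₀ ≤ (N : ℝ) := le_trans (Nat.le_ceil X₀) (by exact_mod_cast hceil)
  have h3 : (3 : ℝ) ≤ N := by exact_mod_cast le_trans (le_max_right _ _) hN
  have hNpos : (0 : ℝ) < N := by linarith
  have hlogpos : 0 < Real.log N := Real.log_pos (by linarith)
  refine le_trans (hN₁ N hN₁' Ψ hΨ hL r u v huv) ?_
  rw [Real.rpow_sub hNpos, Real.rpow_one]
  exact div_le_div_of_nonneg_left hNpos.le (Real.rpow_pos_of_pos hlogpos A) (hX₀ N hX)

/-! ### §N Negation: the Siegel chain -/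

/-- KERNEL-CHECKED: in the illusory world (Siegel zeros of unbounded quality; modulo the vendored
Matomäki–Merikoski Theorem 1.3), the crux is FALSE as soon as the route's other two binders of `closes` hold —
by the route's own deciding theorem and the tree's
`PairsToGHL.Negative.not_generalizedHardyLittlewood_of_unboundedSiegelZeros` (witness: the PAIR system
`(n, n + 2q)`, `N = q^{10}`, `L = 3`). Contrapositively any proof of `PairCores ∧ HigherCores ∧ OpeningReduction`
bounds the quality of Siegel zeros. -/
theorem not_pairCores_of_unboundedSiegelZeros
    (hMM : Literature.Barriers.Parity.MatomakiMerikoski2023_pairCorrelation)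
    (hU : Literature.Barriers.Parity.UnboundedSiegelZeros)
    (hH : HigherCores) (hR : OpeningReduction) : ¬ PairCores := fun hP =>
  Summit.Parity.GeneralizedHardyLittlewood.Theorems.PairsToGHL.Negative.not_generalizedHardyLittlewood_of_unboundedSiegelZeros
    hMM hU (closes hP hH hR)

/-- Dickson–Hardy–Littlewood at `d = 1` for PAIR systems (the `t = 2` slice of `OpeningReduction`'s conclusion). -/
def DimOnePairs : Prop :=
  ∀ (L : ℕ) (ε : ℝ), 0 < ε → ∃ N₀ : ℕ, ∀ N : ℕ, N₀ ≤ N →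
    ∀ Ψ : Fin 2 → Literature.NumberTheory.Sieve.AffLinForm 1,
      Literature.NumberTheory.Sieve.IsNondegenerateSystem Ψ →
      Literature.NumberTheory.Sieve.affLinSize Ψ N ≤ L →
      ∀ K : Set (Fin 1 → ℝ), Convex ℝ K → K ⊆ Literature.NumberTheory.Sieve.realBox 1 N →
        |Literature.NumberTheory.Sieve.vonMangoldtSum Ψ K N -
            Literature.NumberTheory.Sieve.archFactor Ψ K * Literature.NumberTheory.Sieve.singularProduct Ψ| ≤
          ε * (N : ℝ)

/-- The `t = 2` opening bookkeeping at level `0` (PROVABLE, L: Bombieri–Vinogradov for the two one-prime terms,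
the `t = 2` truncated singular series `𝔖 + 𝔖 − 𝔖` for `T_∅`; = the route's TwinReduction made shift-uniform):
level-`0` cores ⇒ Hardy–Littlewood for every pair system, shift-uniform. -/
def OpeningAtLevelZero : Prop := LevelZero → DimOnePairs

/-- The illusory-world kill of shift-uniform HL for pairs: PROVABLE (modulo the vendored MM fact) by the
proof of `not_generalizedHardyLittlewood_of_unboundedSiegelZeros` verbatim — its witness `(n, n + 2q)` IS a
pair system and it only ever uses the `d = 1`, `t = 2` instance of the conjecture. -/
def SiegelKillsPairs : Prop := Literature.Barriers.Parity.UnboundedSiegelZeros → ¬ DimOnePairs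

/-- The sharper negation chain (without HigherCores/OpeningReduction): typed; both hypotheses are
provable bookkeeping, the third is the unprovable obstruction. -/
theorem negation_chain : OpeningAtLevelZero → SiegelKillsPairs →
    Literature.Barriers.Parity.UnboundedSiegelZeros → ¬ PairCores :=
  fun hO hS hU hP => hS hU (hO (levelZero_of_pairCores hP))

end Summit.Parity.GeneralizedHardyLittlewood.Cruxes.PairCores.Strategist
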